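import Mathlib
import HarnessLib

/-!
# Item `LrcModEntire` (stmt-NavierStokesRegularity-20428) — (Q3∞) toolkit: the CROSS-SECTION MAXIMUM is continuous under hull + branch convergence

ns-k2-port-2 g5 (helper prover under the LEAD of item 20428, ns-poloidal-K2-p3 g14; `--supports stmt-NavierStokesRegularity-20428 --as helper`).
Memo `Cruxes/LrcModEntire/T2B-g14.md` §13b (Q3∞): the lever's observable is the VALUE `𝓡_v(s; τ, z) = max_{|n| ≤ r} σv₂(−1+τ, γ(s) + nν(s) + z e₂)`; to homogenise it along a hull limit
(`…RidgeHullTools.eq_lim_of_tendsto_shift`) one needs `𝓡_v(s_k + s; τ, z) → 𝓡_U(s; τ, z)` when the translated slices converge locally uniformly and the re-based branch points / normals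
converge.  Generic, class-free:

* `tendsto_sSup_image` — `gₖ → g` uniformly on a non-empty compact `K`, all continuous on `K` ⇒ `sSup (gₖ '' K) → sSup (g '' K)`;
* `tendstoUniformlyOn_comp_of_tendstoLocallyUniformly` — `Fₖ → F` locally uniformly (`F` continuous), parametrisations `pₖ → p` uniformly on a compact `S` (`p` continuous on `S`)
  ⇒ `Fₖ ∘ pₖ → F ∘ p` uniformly on `S`;
* `tendstoUniformlyOn_line` — `cₖ → c`, `dₖ → d` ⇒ `n ↦ cₖ + n • dₖ + w` → `n ↦ c + n • d + w` uniformly on `[−r, r]`;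
* `tendsto_crossSectionMax` — **the cross-section maximum `sSup ((n ↦ σ·(Vₖ (cₖ + n•dₖ + w))₂) '' [−r,r])` converges to that of the limit** (`Vₖ → V` locally uniformly on `ℝ³`, all continuous,
  `cₖ → c`, `dₖ → d`).

WHAT THIS IS NOT: not a claim about Navier–Stokes regularity — analysis bricks for the (Q3∞) hull homogenisation of a necessary condition on hypothetical profiles (bears_on LADDER-NS N0,
item 20428 / crux 19708; 20428/19708/27893 OPEN).  No summit statement is proved here.
-/

noncomputable section

-- the summit and its single sub-problem share the name (CONVENTIONS §1), as in every Theorems file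
set_option linter.dupNamespace false

namespace Summit.NavierStokesRegularity.NavierStokesRegularity.Theorems.PoloidalWindowDoorLrcModEntireRidgeHullSup

open Set Filter Topology Metric Function

/-! ### Suprema over a compact set under uniform convergence -/

/-- **`sSup` over a non-empty compact set is continuous under uniform convergence** of continuous functions. [folklore] -/
theorem tendsto_sSup_image {X : Type*} [TopologicalSpace X] {K : Set X} (hK : IsCompact K) (hKne : K.Nonempty)
    {g : ℕ → X → ℝ} {g₀ : X → ℝ} (hgc : ∀ k, ContinuousOn (g k) K) (hg₀c : ContinuousOn g₀ K) (hlim : TendstoUniformlyOn g g₀ atTop K) :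
    Tendsto (fun k => sSup (g k '' K)) atTop (𝓝 (sSup (g₀ '' K))) := by
  rw [Metric.tendsto_atTop]
  intro ε hε
  have h := (Metric.tendstoUniformlyOn_iff.1 hlim) (ε / 2) (by linarith)
  obtain ⟨N, hN⟩ := eventually_atTop.1 h
  refine ⟨N, fun k hk => ?_⟩
  have hbd₀ : BddAbove (g₀ '' K) := (hK.image_of_continuousOn hg₀c).bddAbove
  have hbdk : BddAbove (g k '' K) := (hK.image_of_continuousOn (hgc k)).bddAbove
  have hne₀ : (g₀ '' K).Nonempty := hKne.image _
  have hnek : (g k '' K).Nonempty := hKne.image _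
  -- `sSup (g k '' K) ≤ sSup (g₀ '' K) + ε/2` and symmetrically
  have h1 : sSup (g k '' K) ≤ sSup (g₀ '' K) + ε / 2 := by
    refine csSup_le hnek ?_
    rintro _ ⟨x, hx, rfl⟩
    have hd := hN k hk x hx
    rw [Real.dist_eq] at hd
    have : g₀ x ≤ sSup (g₀ '' K) := le_csSup hbd₀ ⟨x, hx, rfl⟩
    linarith [(abs_lt.1 hd).1, (abs_lt.1 hd).2]
  have h2 : sSup (g₀ '' K) ≤ sSup (g k '' K) + ε / 2 := by
    refine csSup_le hne₀ ?_
    rintro _ ⟨x, hx, rfl⟩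
    have hd := hN k hk x hx
    rw [Real.dist_eq] at hd
    have : g k x ≤ sSup (g k '' K) := le_csSup hbdk ⟨x, hx, rfl⟩
    linarith [(abs_lt.1 hd).1, (abs_lt.1 hd).2]
  rw [Real.dist_eq, abs_lt]
  constructor <;> linarith

/-! ### Moving parametrisations under locally uniform convergence -/

/-- **Locally uniform convergence composed with uniformly convergent parametrisations**: `Fₖ → F` locally uniformly on a proper space with `F` continuous, `pₖ → p` uniformly on a
compact `S` with `p` continuous on `S` ⇒ `Fₖ ∘ pₖ → F ∘ p` uniformly on `S`. [folklore] -/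
theorem tendstoUniformlyOn_comp_of_tendstoLocallyUniformly {E : Type*} [MetricSpace E] [ProperSpace E] {Y : Type*} [PseudoMetricSpace Y] {T : Type*}
    {F : ℕ → E → Y} {F₀ : E → Y} (hF : TendstoLocallyUniformly F F₀ atTop) (hF₀ : Continuous F₀)
    {S : Set T} [TopologicalSpace T] (hS : IsCompact S) {p : ℕ → T → E} {p₀ : T → E} (hp₀ : ContinuousOn p₀ S)
    (hp : TendstoUniformlyOn p p₀ atTop S) : TendstoUniformlyOn (fun k t => F k (p k t)) (fun t => F₀ (p₀ t)) atTop S := by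
  rw [Metric.tendstoUniformlyOn_iff]
  intro ε hε
  -- a compact neighbourhood of `p₀ '' S`
  set K : Set E := cthickening 1 (p₀ '' S) with hK
  have hKc : IsCompact K := (hS.image_of_continuousOn hp₀).cthickening
  -- uniform convergence of `F` on `K` and uniform continuity of `F₀` on `K`
  have h1 : ∀ᶠ k in atTop, ∀ y ∈ K, dist (F₀ y) (F k y) < ε / 2 := by
    have := (tendstoLocallyUniformly_iff_forall_isCompact.1 hF) K hKc
    rw [Metric.tendstoUniformlyOn_iff] at this
    exact this (ε / 2) (by linarith)
  obtain ⟨δ, hδ, hδF⟩ := Metric.uniformContinuousOn_iff.1 (hKc.uniformContinuousOn_of_continuous hF₀.continuousOn) (ε / 2) (by linarith)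
  have h2 : ∀ᶠ k in atTop, ∀ t ∈ S, dist (p₀ t) (p k t) < min δ 1 :=
    (Metric.tendstoUniformlyOn_iff.1 hp) (min δ 1) (lt_min hδ one_pos)
  filter_upwards [h1, h2] with k hk1 hk2 t ht
  have hpt : dist (p₀ t) (p k t) < min δ 1 := hk2 t ht
  have hz : p₀ t ∈ K := self_subset_cthickening _ ⟨t, ht, rfl⟩
  have hy : p k t ∈ K := by
    refine Metric.mem_cthickening_of_dist_le (p k t) (p₀ t) 1 _ ⟨t, ht, rfl⟩ ?_
    rw [dist_comm]; exact (hpt.trans_le (min_le_right _ _)).le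
  calc dist (F₀ (p₀ t)) (F k (p k t)) ≤ dist (F₀ (p₀ t)) (F₀ (p k t)) + dist (F₀ (p k t)) (F k (p k t)) := dist_triangle _ _ _
    _ < ε / 2 + ε / 2 := add_lt_add (hδF _ hz _ hy (hpt.trans_le (min_le_left _ _))) (hk1 _ hy)
    _ = ε := by ring

/-- **Straight cross-sections with converging base points and directions converge uniformly on `[−r, r]`**: `cₖ → c`, `dₖ → d` ⇒ `n ↦ cₖ + n • dₖ + w` → `n ↦ c + n • d + w`
uniformly on `Icc (−r) r`. [folklore] -/
theorem tendstoUniformlyOn_line {E : Type*} [NormedAddCommGroup E] [NormedSpace ℝ E] {c d : ℕ → E} {c₀ d₀ : E} (hc : Tendsto c atTop (𝓝 c₀)) (hd : Tendsto d atTop (𝓝 d₀))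
    (w : E) (r : ℝ) : TendstoUniformlyOn (fun k n => c k + n • d k + w) (fun n => c₀ + n • d₀ + w) atTop (Icc (-r) r) := by
  rw [Metric.tendstoUniformlyOn_iff]
  intro ε hε
  set R : ℝ := max r 1 with hR
  have hR1 : 1 ≤ R := le_max_right _ _
  have hR0 : 0 < R := by linarith
  have h1 : ∀ᶠ k in atTop, dist (c k) c₀ < ε / 2 := Metric.tendsto_nhds.1 hc _ (by linarith)
  have h2 : ∀ᶠ k in atTop, dist (d k) d₀ < ε / (2 * R) := Metric.tendsto_nhds.1 hd _ (by positivity)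
  filter_upwards [h1, h2] with k hk1 hk2 n hn
  have hnR : |n| ≤ R := (abs_le.2 ⟨hn.1, hn.2⟩).trans (le_max_left _ _)
  rw [dist_eq_norm] at hk1 hk2 ⊢
  have e : c₀ + n • d₀ + w - (c k + n • d k + w) = (c₀ - c k) + n • (d₀ - d k) := by
    rw [smul_sub]; abel
  rw [e]
  calc ‖c₀ - c k + n • (d₀ - d k)‖ ≤ ‖c₀ - c k‖ + ‖n • (d₀ - d k)‖ := norm_add_le _ _
    _ = ‖c k - c₀‖ + |n| * ‖d k - d₀‖ := by rw [norm_sub_rev, norm_smul, Real.norm_eq_abs, norm_sub_rev d₀]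
    _ < ε / 2 + R * (ε / (2 * R)) := by
        refine add_lt_add_of_lt_of_le hk1 ?_
        exact mul_le_mul hnR hk2.le (norm_nonneg _) hR0.le
    _ = ε := by field_simp; ring

/-! ### The cross-section maximum under hull + branch convergence -/

/-- **The cross-section maximum is continuous under hull + branch convergence.**  If the (translated) slices `Vₖ → V` converge locally uniformly on `ℝ³` (all continuous), the base
points `cₖ → c` and the directions `dₖ → d`, then for every sign `σ`, shift `w` and radius `r ≥ 0`:
`sSup ((n ↦ σ·(Vₖ (cₖ + n•dₖ + w))₂) '' [−r,r]) → sSup ((n ↦ σ·(V (c + n•d + w))₂) '' [−r,r])`. [folklore] -/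
theorem tendsto_crossSectionMax {V : ℕ → EuclideanSpace ℝ (Fin 3) → EuclideanSpace ℝ (Fin 3)} {V₀ : EuclideanSpace ℝ (Fin 3) → EuclideanSpace ℝ (Fin 3)}
    (hV : TendstoLocallyUniformly V V₀ atTop) (hVc : ∀ k, Continuous (V k)) (hV₀c : Continuous V₀)
    {c d : ℕ → EuclideanSpace ℝ (Fin 3)} {c₀ d₀ : EuclideanSpace ℝ (Fin 3)} (hc : Tendsto c atTop (𝓝 c₀)) (hd : Tendsto d atTop (𝓝 d₀))
    (σ : ℝ) (w : EuclideanSpace ℝ (Fin 3)) {r : ℝ} (hr : 0 ≤ r) :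
    Tendsto (fun k => sSup ((fun n : ℝ => σ * V k (c k + n • d k + w) 2) '' Icc (-r) r)) atTop
      (𝓝 (sSup ((fun n : ℝ => σ * V₀ (c₀ + n • d₀ + w) 2) '' Icc (-r) r))) := by
  -- the scalar slices `σ·(·)₂ ∘ V` converge locally uniformly
  have h2 : UniformContinuous fun x : EuclideanSpace ℝ (Fin 3) => σ * x 2 := by
    have : (fun x : EuclideanSpace ℝ (Fin 3) => σ * x 2) = ⇑(σ • EuclideanSpace.proj (𝕜 := ℝ) (2 : Fin 3)) := by
      funext x; simp
    rw [this]; exact (σ • EuclideanSpace.proj (𝕜 := ℝ) (2 : Fin 3)).uniformContinuous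
  have hc2 : Continuous fun x : EuclideanSpace ℝ (Fin 3) => σ * x 2 := h2.continuous
  have hF : TendstoLocallyUniformly (fun k x => σ * V k x 2) (fun x => σ * V₀ x 2) atTop := h2.comp_tendstoLocallyUniformly hV
  -- the parametrisations
  have hp := tendstoUniformlyOn_line hc hd w r
  have hp₀ : ContinuousOn (fun n : ℝ => c₀ + n • d₀ + w) (Icc (-r) r) := by fun_prop
  have hcomp := tendstoUniformlyOn_comp_of_tendstoLocallyUniformly hF (hc2.comp hV₀c) isCompact_Icc hp₀ hp
  refine tendsto_sSup_image isCompact_Icc ⟨0, ⟨by linarith, hr⟩⟩ (fun k => ?_) ?_ hcomp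
  · exact ((hc2.comp (hVc k)).comp (by fun_prop : Continuous fun n : ℝ => c k + n • d k + w)).continuousOn
  · exact ((hc2.comp hV₀c).comp (by fun_prop : Continuous fun n : ℝ => c₀ + n • d₀ + w)).continuousOn

end Summit.NavierStokesRegularity.NavierStokesRegularity.Theorems.PoloidalWindowDoorLrcModEntireRidgeHullSup

end
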